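import Summits.ResolutionOfSingularities.ResolutionOfSingularities.Theorems.FrobeniusClosingPatchingRelPerfectDepthLegalTrace
import Summits.ResolutionOfSingularities.ResolutionOfSingularities.Theorems.FrobeniusClosingPatchingRelPerfectDepthFlagPrephaseBad
import Literature.AlgebraicGeometry.Resolution.ExceptionalDivisorGenericOrder
import Literature.AlgebraicGeometry.Resolution.BlowupExceptionalFibreIrreducible
import Literature.AlgebraicGeometry.Resolution.PermissibleCentres
import Literature.AlgebraicGeometry.Resolution.BlowupsIntegral
import Literature.AlgebraicGeometry.Resolution.NormalCrossingsStrictification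
import Literature.AlgebraicGeometry.Resolution.ExcellentBlowup
import Literature.AlgebraicGeometry.Resolution.MaximalContactPersistence
import Literature.AlgebraicGeometry.Resolution.MonomialOrderReductionUnit
import Literature.AlgebraicGeometry.Resolution.DivisorialPartLemmas
import HarnessLib

/-!
# Crux `PatchingRelPerfect` (stmt-ResolutionOfSingularities-16161), chain W5.2 — T6-E1b residual `LegalScopedDivisorReduction₃`,
# PHASE 2 closer (2b) «SURFACE-TRACE SEPARATION GAME», brick B4/A1: the POINT MOVE (P) with every invariant STEP A carries

[OURS · L1 W5.2 · res-L1-w52-stub-1 g4 for B4 «STEP A» (res-L1-w52-plan-1 NAMING N7 2026-08-27T12:35:33Z) over res-L1-w52-lead-1's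
B1 `DepthLegal.HostState` (p531308)] Replaces the role of NO printed item; NOT a statement of the manuscript under review; fact-free.

STEP A of the separation game (plan `L/res-L1-w52-lead-1/PHASE2-SEPARATION-GAME.md` v2) runs Cossart–Jannsen–Saito with `dim X = 1`
INSIDE the regular surface `X = V(D)` on the trace curve `Supp T`, `T := (monomialIdeal L)|_X`, and LIFTS each of its point blow-ups
to the point blow-up (P) of the ambient `E`.  This brick is the single lifted move with everything the transport must carry:

* §1 a CLOSED POINT is an snc-adapted legal centre: `hasSNCWith_vanishingIdeal_singleton` (a closed point has normal crossings
  with every snc boundary), `isGenericPoint_singleton`;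
* §2 **`HostState.pointMove`** = B1's `HostState.step` at `Z = {p}`, `p ∈ V(D) ∩ Supp M`, and `pointMove_cons` (the running
  `IsPureWeightedSeq 2` grows by one legal step);
* §3 the state clauses one floor up: `IsIntegral`, `IsNoetherian`, `Scheme.IsExcellent` of the blown-up `E′`;
* §4 **`HostState.curve_pointMove`** — the «NO HOST COMPONENT INSIDE `Supp M`» clause (`∀ x ∈ V(D) ∩ Supp M, 1 < coheight x`, i.e.
  the trace is a CURVE; `HostBoundary₃`'s last clause) SURVIVES the point move: off the exceptional divisor the stalk maps are
  isomorphisms (codimension is preserved, supports pull back); on it, a point of codimension `≤ 1` is the generic point of the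
  (irreducible) exceptional divisor, where the weight-one controlled transform of the order-one host is a UNIT
  (`IsBlowup.idealOrder_controlledTransform_genericPoint_preimage`: `ord = 1 − 1`).

The trace-support bookkeeping through the move and the CJS(dim 1) induction are the next bricks of B4.
AI-written; AI review is weaker than expert review.

## References
* E. Bierstone, D. Grigoriev, P. Milman, J. Włodarczyk, arXiv:1206.3090, Def. 3.1.3 (2), Lemma 3.6.4 (4). [BierstoneGrigorievMilmanWlodarczyk2011]
* V. Cossart, O. Piltant, J. Algebra 320 (2008), proof of Prop. 4.2, (10)–(11) (orders along the exceptional divisor). [CossartPiltant2008]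
* J. Kollár, *Lectures on Resolution of Singularities* (2007), 3.30.2. [Kollar2007]
-/

-- `Summit.<Summit>.<Sub>.Theorems` with `Sub = Summit` (single-conjunct summit, D-0017)
set_option linter.dupNamespace false

noncomputable section

open CategoryTheory CategoryTheory.Limits AlgebraicGeometry TopologicalSpace IsLocalRing
open Literature.AlgebraicGeometry.Resolution Scheme.IdealSheafData

namespace Summit.ResolutionOfSingularities.ResolutionOfSingularities.Theorems

universe u

namespace DepthLegal

open WeightTwoB DepthTargets

variable {E : Scheme.{u}}

/-! ## §1 A closed point is an snc-adapted centre -/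

/-- A closed point is the generic point of itself. [folklore] -/
theorem isGenericPoint_singleton {p : E} (hp : IsClosed ({p} : Set E)) :
    IsGenericPoint p ((⟨{p}, hp⟩ : Closeds E) : Set E) :=
  hp.closure_eq

/-- **A closed point has normal crossings with every snc boundary**: at `p` the centre `𝓘({p})_p = 𝔪_p` is generated by ALL the
adapted parameters; elsewhere the centre is absent. [cite: BierstoneGrigorievMilmanWlodarczyk2011, Def. 3.1.3 (2)] -/
theorem hasSNCWith_vanishingIdeal_singleton {B : List E.IdealSheafData} (hB : HasSNC B) {p : E}
    (hp : IsClosed ({p} : Set E)) : HasSNCWith B (vanishingIdeal ⟨{p}, hp⟩) := by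
  intro x
  obtain ⟨hreg, u, hu, hι, -⟩ := hB x
  refine ⟨hreg, u, hu, hι, fun hx => ⟨Set.univ, ?_⟩⟩
  have hxp : x = p := by
    have h : x ∈ (((vanishingIdeal (⟨{p}, hp⟩ : Closeds E)).support : Set E)) := hx
    rw [Scheme.IdealSheafData.coe_support_vanishingIdeal] at h
    exact h
  subst hxp
  rw [Set.image_univ, stalkIdeal_vanishingIdeal_singleton hp, hu]

/-- The interior of a closed point of codimension `> 0` is empty. [folklore] -/
theorem interior_singleton_eq_empty {p : E} (hcoh : 0 < Order.coheight p) : interior ({p} : Set E) = ∅ := by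
  by_contra hne
  obtain ⟨x, hx⟩ := Set.nonempty_iff_ne_empty.mpr hne
  have hxp : x = p := Set.mem_singleton_iff.mp (interior_subset hx)
  subst hxp
  have hopen : IsOpen ({x} : Set E) := by
    have heq : interior ({x} : Set E) = {x} :=
      Set.Subset.antisymm interior_subset (Set.singleton_subset_iff.mpr hx)
    rw [← heq]
    exact isOpen_interior
  have h0 : Order.coheight x = 0 := by
    rw [Order.coheight_eq_zero]
    intro y hxy
    have hyx : y ⤳ x := Scheme.le_iff_specializes.mp hxy
    have hy : y ∈ ({x} : Set E) := hyx.mem_open hopen rfl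
    rw [Set.mem_singleton_iff.mp hy]
  rw [h0] at hcoh
  exact lt_irrefl _ hcoh

namespace HostState

/-! ## §2 The point move -/

section Move

variable [IsLocallyNoetherian E] {H D : E.IdealSheafData} {L : List (E.IdealSheafData × ℕ)} (S : HostState H D L)
  {p : E} (hp : IsClosed ({p} : Set E)) {E' : Scheme.{u}} {τ : E' ⟶ E}

include S in
/-- The centre `{p}` of a point move is a regular subscheme. [folklore] -/
theorem isRegular_subscheme_singleton : Scheme.IsRegular (vanishingIdeal ⟨{p}, hp⟩).subscheme :=
  (hasSNCWith_vanishingIdeal_singleton S.sncB hp).isRegular_subscheme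

include S in
/-- [OURS · L1 W5.2] **THE POINT MOVE (P)**: blowing up a closed point `p ∈ V(D) ∩ Supp M` transports the state of the separation
game (B1's `HostState.step` at `Z = {p}`): new host `τᶜ(D,1)` (a regular hypersurface), new boundary
`stepExp L τ 𝓘({p}) (weightAt L p − 1)` (snc), `τᶜ(H,2)` their product. [cite: BierstoneGrigorievMilmanWlodarczyk2011, Lemma 3.6.4 (4)]
[cite: Kollar2007, (3.111) Step 1] -/
theorem pointMove (hpD : p ∈ D.support) (hpM : p ∈ (monomialIdeal L).support)
    (hτ : IsBlowup τ (vanishingIdeal ⟨{p}, hp⟩)) :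
    @HostState E' hτ.isLocallyNoetherian (controlledTransform τ (vanishingIdeal ⟨{p}, hp⟩) H 2)
      (controlledTransform τ (vanishingIdeal ⟨{p}, hp⟩) D 1)
      (stepExp L τ (vanishingIdeal ⟨{p}, hp⟩) (weightAt L p - 1)) :=
  S.step (isGenericPoint_singleton hp) (S.isRegular_subscheme_singleton hp) (Set.singleton_subset_iff.mpr hpD)
    (Set.singleton_subset_iff.mpr hpM) (hasSNCWith_vanishingIdeal_singleton S.sncB hp) hτ

include S in
/-- The point move as one pure-weight-two step appended to the running sequence. [folklore] -/
theorem pointMove_cons {E₀ : Scheme.{u}} {ρ : E ⟶ E₀} {H₀ : E₀.IdealSheafData} (hseq : IsPureWeightedSeq 2 ρ H₀ H)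
    (hpD : p ∈ D.support) (hpM : p ∈ (monomialIdeal L).support) (hτ : IsBlowup τ (vanishingIdeal ⟨{p}, hp⟩)) :
    IsPureWeightedSeq 2 (τ ≫ ρ) H₀ (controlledTransform τ (vanishingIdeal ⟨{p}, hp⟩) H 2) :=
  S.isPureWeightedSeq_cons hseq (S.isRegular_subscheme_singleton hp) (Set.singleton_subset_iff.mpr hpD)
    (Set.singleton_subset_iff.mpr hpM) hτ

end Move

/-! ## §3 State clauses one floor up -/

section Clauses

variable {p : E} (hp : IsClosed ({p} : Set E)) {E' : Scheme.{u}} {τ : E' ⟶ E}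

/-- The blown-up scheme is integral (the centre is a PROPER closed point: `𝓘({p}) ≠ ⊥`). [folklore] -/
theorem isIntegral_pointMove [IsIntegral E] (hne : vanishingIdeal (⟨{p}, hp⟩ : Closeds E) ≠ ⊥)
    (hτ : IsBlowup τ (vanishingIdeal ⟨{p}, hp⟩)) : IsIntegral E' :=
  hτ.isIntegral hne

/-- The blown-up scheme is Noetherian. [folklore] -/
theorem isNoetherian_pointMove [IsNoetherian E] (hτ : IsBlowup τ (vanishingIdeal ⟨{p}, hp⟩)) : IsNoetherian E' :=
  isNoetherian_of_isBlowup hτ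

/-- The blown-up scheme is excellent. [folklore] -/
theorem isExcellent_pointMove [IsLocallyNoetherian E] (hexc : Scheme.IsExcellent E)
    (hτ : IsBlowup τ (vanishingIdeal ⟨{p}, hp⟩)) : Scheme.IsExcellent E' :=
  hτ.isExcellent hexc

/-- The centre of a point move inside a proper closed subset is a non-zero ideal. [folklore] -/
theorem vanishingIdeal_singleton_ne_bot_of_mem {D : E.IdealSheafData} (hD : D ≠ ⊥) [IsIntegral E]
    (hpD : p ∈ D.support) : vanishingIdeal (⟨{p}, hp⟩ : Closeds E) ≠ ⊥ := by
  intro h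
  have hsupp : (((vanishingIdeal (⟨{p}, hp⟩ : Closeds E)).support : Set E)) = Set.univ := by
    rw [h, Scheme.IdealSheafData.support_bot]; rfl
  rw [Scheme.IdealSheafData.coe_support_vanishingIdeal] at hsupp
  -- `{p} = univ`: the generic point is `p`, so `D` vanishes at the generic point, `D = ⊥`
  have hgen : genericPoint E = p := by
    have : genericPoint E ∈ ({p} : Set E) := by rw [show (({p} : Set E)) = Set.univ from hsupp]; exact Set.mem_univ _
    exact this
  exact not_mem_support_genericPoint hD (hgen ▸ hpD)

end Clauses

/-! ## §4 The «no host component inside `Supp M`» clause survives the point move -/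

section Curve

variable [IsLocallyNoetherian E] {H D : E.IdealSheafData} {L : List (E.IdealSheafData × ℕ)} (S : HostState H D L)
  {p : E} (hp : IsClosed ({p} : Set E)) {E' : Scheme.{u}} {τ : E' ⟶ E}

include S in
/-- At a point of the host the host has order exactly one. [cite: BierstoneGrigorievMilmanWlodarczyk2011, Lemma 3.6.4 (4)] -/
theorem idealOrder_host_eq_one {x : E} (hx : x ∈ D.support) : idealOrder D x = 1 := by
  obtain ⟨v, hv, hv2⟩ := S.hostHyp x hx
  apply le_antisymm
  · -- `ord ≤ 1`: the generator is not in `𝔪²`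
    by_contra hlt
    have h2 : (2 : ℕ∞) ≤ idealOrder D x := by
      have h := not_le.mp hlt
      have h' : (1 : ℕ∞) < idealOrder D x := h
      exact Order.add_one_le_of_lt h'
    have hle := (le_idealOrder_iff D x 2).mp h2
    rw [hv] at hle
    exact hv2 (hle (Ideal.mem_span_singleton_self v))
  · exact_mod_cast (one_le_idealOrder_iff D x).mpr hx

include S in
/-- [OURS · L1 W5.2] **«No host component inside `Supp M`» is INVARIANT under the point move.**  If every point of `V(D) ∩ Supp M`
has codimension `> 1` in `E`, then every point of `V(D′) ∩ Supp M′` has codimension `> 1` in `E′` (`D′ = τᶜ(D,1)`,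
`M′ = monomialIdeal L′ ≤`-supported over `Supp M` and the centre).  Off the exceptional divisor: stalk isomorphisms.  On it: a point
of codimension `≤ 1` of the exceptional divisor is its generic point, where `ord τᶜ(D,1) = ord_p D − 1 = 0`.
[cite: CossartPiltant2008, proof of Prop. 4.2, (10)–(11)] -/
theorem curve_pointMove [IsIntegral E] (hcurve : ∀ x ∈ D.support, x ∈ (monomialIdeal L).support → 1 < Order.coheight x)
    (hpD : p ∈ D.support) (hpM : p ∈ (monomialIdeal L).support) (hτ : IsBlowup τ (vanishingIdeal ⟨{p}, hp⟩)) :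
    ∀ x' ∈ (controlledTransform τ (vanishingIdeal ⟨{p}, hp⟩) D 1).support,
      x' ∈ (monomialIdeal (stepExp L τ (vanishingIdeal ⟨{p}, hp⟩) (weightAt L p - 1))).support →
        1 < Order.coheight x' := by
  haveI : IsLocallyNoetherian E' := hτ.isLocallyNoetherian
  have hS' := S.pointMove hp hpD hpM hτ
  intro x' hxD' hxM'
  -- the new boundary monomial is `τᶜ(M,1)`, supported over `Supp M`; the new host over `V(D)`
  have hM' : monomialIdeal (stepExp L τ (vanishingIdeal ⟨{p}, hp⟩) (weightAt L p - 1)) =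
      controlledTransform τ (vanishingIdeal ⟨{p}, hp⟩) (monomialIdeal L) 1 :=
    (S.bd_transform (isGenericPoint_singleton hp) (Set.singleton_subset_iff.mpr hpM)
      (hasSNCWith_vanishingIdeal_singleton S.sncB hp) hτ).symm
  have hτxM : τ x' ∈ (monomialIdeal L).support := by
    rw [hM'] at hxM'
    exact support_controlledTransform_subset_preimage (π := τ) (C := vanishingIdeal ⟨{p}, hp⟩) (monomialIdeal L) 1 hxM'
  have hτxD : τ x' ∈ D.support :=
    support_controlledTransform_subset_preimage (π := τ) (C := vanishingIdeal ⟨{p}, hp⟩) D 1 hxD'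
  by_contra hle
  rw [not_lt] at hle
  by_cases hxp : τ x' = p
  · /- on the exceptional divisor: `x'` is its generic point, where `τᶜ(D,1)` is a unit -/
    have hp1 : 1 < Order.coheight p := hcurve p hpD hpM
    haveI : IsRegularLocalRing (E.presheaf.stalk p) := S.regE p
    -- `𝔪_p ≠ ⊥` (else `coheight p = 0`)
    have hne : maximalIdeal (E.presheaf.stalk p) ≠ ⊥ := by
      intro h0
      have hfield : IsField (E.presheaf.stalk p) := IsLocalRing.isField_iff_maximalIdeal_eq.mpr h0
      have hdim : ringKrullDim (E.presheaf.stalk p) = 0 := ringKrullDim_eq_zero_of_isField hfield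
      rw [ringKrullDim_stalk_eq_coheight] at hdim
      have : Order.coheight p = 0 := by exact_mod_cast hdim
      rw [this] at hp1
      exact not_lt_zero hp1
    -- the host is non-zero (order-one generator at `p`), so the centre is a proper non-zero ideal
    have hD0 : D ≠ ⊥ := by
      intro h
      obtain ⟨v, hv, hv2⟩ := S.hostHyp p hpD
      subst h
      rw [stalkIdeal_bot] at hv
      have hv0 : v = 0 := by simpa using (Ideal.span_singleton_eq_bot.mp hv.symm)
      exact hv2 (hv0 ▸ Ideal.zero_mem _)
    have hCne : vanishingIdeal (⟨{p}, hp⟩ : Closeds E) ≠ ⊥ := vanishingIdeal_singleton_ne_bot_of_mem hp hD0 hpD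
    have hgen0 : Order.coheight (genericPoint E) = 0 :=
      Order.coheight_eq_zero.mpr fun y _ =>
        Scheme.le_iff_specializes.mpr ((genericPoint_spec E).specializes (show y ∈ (⊤ : Set E) from trivial))
    have hCtop : (vanishingIdeal (⟨{p}, hp⟩ : Closeds E)).support ≠ ⊤ := by
      intro h
      have h' : (((vanishingIdeal (⟨{p}, hp⟩ : Closeds E)).support : Set E)) = Set.univ := by rw [h]; rfl
      rw [Scheme.IdealSheafData.coe_support_vanishingIdeal] at h'
      have hgen : genericPoint E = p := by
        have : genericPoint E ∈ ({p} : Set E) := by rw [show (({p} : Set E)) = Set.univ from h']; exact Set.mem_univ _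
        exact this
      rw [hgen] at hgen0
      rw [hgen0] at hp1
      exact not_lt_zero hp1
    -- the exceptional divisor `G = τ⁻¹{p}` is irreducible, closed, with generic point `ζ`
    have hirr : IsIrreducible (τ ⁻¹' ({p} : Set E)) :=
      hτ.isIrreducible_preimage_singleton p (stalkIdeal_vanishingIdeal_singleton hp) hne
    have hGc : IsClosed (τ ⁻¹' ({p} : Set E)) := hp.preimage τ.continuous
    have hζ : IsGenericPoint hirr.genericPoint (τ ⁻¹' ((⟨{p}, hp⟩ : Closeds E) : Set E)) := by
      have h := hirr.isGenericPoint_genericPoint_closure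
      rwa [hGc.closure_eq] at h
    set ζ := hirr.genericPoint with hζdef
    have hxG : x' ∈ τ ⁻¹' ({p} : Set E) := hxp
    -- `ζ ⤳ x'`, and `ζ` is not the generic point of `E'` (it lies on the exceptional divisor)
    have hζx : ζ ⤳ x' := hζ.specializes hxG
    haveI : IsIntegral E' := hτ.isIntegral hCne
    have hexc : (vanishingIdeal (⟨{p}, hp⟩ : Closeds E)).comap τ ≠ ⊥ := hτ.comap_ne_bot hCtop hCne
    have hGexc : ∀ y : E', y ∈ τ ⁻¹' ({p} : Set E) →
        y ∈ ((((vanishingIdeal (⟨{p}, hp⟩ : Closeds E)).comap τ).support : Set E')) := fun y hy => by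
      rw [Scheme.IdealSheafData.support_comap, Closeds.coe_preimage, Scheme.IdealSheafData.coe_support_vanishingIdeal]
      exact hy
    have h1ζ : 1 ≤ Order.coheight ζ := by
      rw [Order.one_le_iff_ne_zero, Order.coheight_ne_zero]
      intro hmax
      have hle : ζ ≤ genericPoint E' := Scheme.le_iff_specializes.mpr ((genericPoint_spec E').specializes trivial)
      -- `IsMax ζ` would make `ζ ⤳ genericPoint E'`, putting the generic point on the exceptional divisor
      have hsp : ζ ⤳ genericPoint E' := Scheme.le_iff_specializes.mp (hmax hle)
      have hmem : genericPoint E' ∈ τ ⁻¹' ({p} : Set E) := hsp.mem_closed hGc hζ.mem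
      exact not_mem_support_genericPoint hexc (hGexc _ hmem)
    -- hence `x' = ζ`
    have hxζ : ζ = x' := eq_of_specializes_of_coheight_le hζx (ne_top_of_le_ne_top (by decide) hle) (hle.trans h1ζ)
    -- at the generic point of the exceptional divisor the weight-one transform of the order-one host is a unit
    have hord := hτ.idealOrder_controlledTransform_genericPoint_preimage S.regE (S.isRegular_subscheme_singleton hp)
      isIrreducible_singleton (interior_singleton_eq_empty (lt_trans zero_lt_one hp1)) hζ D 1
    rw [show τ ζ = p from hζ.mem, S.idealOrder_host_eq_one hpD] at hord
    have h0 : idealOrder (controlledTransform τ (vanishingIdeal ⟨{p}, hp⟩) D 1) x' = 0 := by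
      rw [← hxζ, hord]; rfl
    have h1 := (one_le_idealOrder_iff _ x').mpr hxD'
    rw [h0] at h1
    exact absurd h1 (by decide)
  · /- off the exceptional divisor: the stalk map at `x'` is an isomorphism -/
    have hxC : τ x' ∉ ((vanishingIdeal (⟨{p}, hp⟩ : Closeds E)).support : Set E) := by
      rw [Scheme.IdealSheafData.coe_support_vanishingIdeal]; exact hxp
    haveI := hτ.isIso_stalkMap_of_not_mem_support hxC
    have hcoh := DepthFlagBad.coheight_eq_of_isIso_stalkMap τ x'
    have h := hcurve (τ x') hτxD hτxM
    rw [hcoh] at h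
    exact not_lt.mpr hle h

end Curve

end HostState

end DepthLegal

end Summit.ResolutionOfSingularities.ResolutionOfSingularities.Theorems
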